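import Summits.CriticalPhenomena.PercolationContinuityZ3.Theorems.Transplant.BoxProdZ2CubeInputs
import Literature.Probability.Percolation.SitePaths
import HarnessLib

/-!
# Internal connectivity of the fat prisms of `X □ ℤ²`: every vertex of `Λ^fat_n(τ) = B_X(τ, ψ n) × Λ_n` (and of its frame images
# `frameSeq`) is joined to the centre by a path of the product graph INSIDE the prism — the `hconn` input of
# `KNLevels.linkIn_subset_biUnion_openConnIn_of_wired` for the wired sources of design (D): the root cube (`hQ0`) and the kit's inner prism
# (elongated routes, p2-g2's `lt_real_of_chain` / advance chains)

builds on p205010 (kernel theorem, internal audit signed; external expert review pending) — nothing in this file uses p205010.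
Lane `prim-bschramm`, seat `prim-bschramm-p3` (order I2 of V56); helper file (`--supports stmt-CriticalPhenomena-4575 --as helper`).

* (`pathIn_ballFin_center` of `BoxProdZ2Boxes`: balls are internally connected from the centre);
* `pathIn_prod_left` / `pathIn_prod_right` — lifting factor paths to the product graph inside `B × P`;
* `pathIn_box_zero` — planar staircase inside `Λ_n` from the origin (`KozmaNitzan.exists_pathIn_Icc`);
* **`pathIn_ufatSeq`** — `s ∈ Λ^fat_n(τ) ⇒ PathIn (X □ ℤ²) Λ^fat_n(τ) (τ, 0) s`; `PathIn.map_iso`; **`pathIn_frameSeq`** — the same for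
  `frameSeq hT V₀ γ v τ n` from its centre `(γ⁻¹ τ, v)`.
[cite: KozmaNitzan2024, §4 p. 19 (the wired cube), Lemma 11 (p. 22)] [cite: GrimmettPercolation1999, §1.6 (paths)]
-/

noncomputable section

namespace Summit.CriticalPhenomena.PercolationContinuityZ3.Theorems

namespace Transplant

namespace BoxProdZ2

open Literature.Probability.Percolation Literature.Probability.LatticeModels SimpleGraph
open Literature.Barriers.CriticalPhenomena (graphBall graphBall_finite mem_graphBall_self graphBall_mono)

variable {W : Type} [DecidableEq W] (X : SimpleGraph W) [X.LocallyFinite]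

omit [DecidableEq W] [X.LocallyFinite] in
/-- Lifting a path of `X` to the product inside `B × P` (planar coordinate fixed in `P`). [folklore] -/
theorem pathIn_prod_left {B : Finset W} {P : Finset (Site 2)} {w₀ w : W} (h : PathIn X (↑B : Set W) w₀ w) {t : Site 2} (ht : t ∈ P) :
    PathIn (X □ zdGraph 2) (↑(B ×ˢ P) : Set (W × Site 2)) (w₀, t) (w, t) := by
  obtain ⟨h0, h⟩ := h
  refine ⟨Finset.mem_coe.2 (Finset.mem_product.2 ⟨Finset.mem_coe.1 h0, ht⟩), ?_⟩
  induction h with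
  | refl => exact Relation.ReflTransGen.refl
  | tail _ hbc ih =>
    exact ih.tail ⟨(boxProd_adj).2 (Or.inl ⟨hbc.1, rfl⟩), Finset.mem_coe.2 (Finset.mem_product.2 ⟨Finset.mem_coe.1 hbc.2, ht⟩)⟩

omit [DecidableEq W] [X.LocallyFinite] in
/-- Lifting a planar path to the product inside `B × P` (fibre coordinate fixed in `B`). [folklore] -/
theorem pathIn_prod_right {B : Finset W} {P : Finset (Site 2)} {t₀ t : Site 2} (h : PathIn (zdGraph 2) (↑P : Set (Site 2)) t₀ t)
    {w : W} (hw : w ∈ B) : PathIn (X □ zdGraph 2) (↑(B ×ˢ P) : Set (W × Site 2)) (w, t₀) (w, t) := by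
  obtain ⟨h0, h⟩ := h
  refine ⟨Finset.mem_coe.2 (Finset.mem_product.2 ⟨hw, Finset.mem_coe.1 h0⟩), ?_⟩
  induction h with
  | refl => exact Relation.ReflTransGen.refl
  | tail _ hbc ih =>
    exact ih.tail ⟨(boxProd_adj).2 (Or.inr ⟨hbc.1, rfl⟩), Finset.mem_coe.2 (Finset.mem_product.2 ⟨hw, Finset.mem_coe.1 hbc.2⟩)⟩

omit [DecidableEq W] [X.LocallyFinite] in
/-- A planar staircase from the origin inside `Λ_n`. [folklore] -/
theorem pathIn_box_zero {n : ℕ} {t : Site 2} (ht : t ∈ box 2 n) : PathIn (zdGraph 2) (↑(box 2 n) : Set (Site 2)) 0 t := by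
  have h0 : (0 : Site 2) ∈ box 2 n := by rw [mem_box]; intro i; simp
  rw [box_eq_Icc] at ht h0 ⊢
  exact KozmaNitzan.exists_pathIn_Icc h0 ht

omit [DecidableEq W] in
/-- **The fat prism is internally connected from its centre.** [cite: KozmaNitzan2024, §4 p. 19] -/
theorem pathIn_ufatSeq [Countable W] {p : unitInterval} (hT : TubeSubcritical X p) (V₀ : Finset W) (τ : W) (n : ℕ) {s : W × Site 2}
    (hs : s ∈ ufatSeq X hT V₀ τ n) : PathIn (X □ zdGraph 2) (↑(ufatSeq X hT V₀ τ n) : Set (W × Site 2)) (τ, 0) s := by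
  rw [ufatSeq] at hs ⊢
  obtain ⟨h1, h2⟩ := Finset.mem_product.1 hs
  have hτ : τ ∈ ballFin X τ (ufatRadius X hT V₀ n) := (mem_ballFin X).2 (mem_graphBall_self X τ _)
  have hA := pathIn_prod_right X (pathIn_box_zero h2) hτ
  have hB := pathIn_prod_left X (pathIn_ballFin_center X τ _ ((mem_ballFin X).1 h1)) h2
  exact hA.trans hB

omit [DecidableEq W] [X.LocallyFinite] in
/-- Graph isomorphisms carry paths inside sets. [folklore] -/
theorem PathIn.map_iso {V' : Type} {G : SimpleGraph (W × Site 2)} {G' : SimpleGraph V'} (φ : G ≃g G') {A : Set (W × Site 2)}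
    {u v : W × Site 2} (h : PathIn G A u v) : PathIn G' (φ '' A) (φ u) (φ v) := by
  obtain ⟨h0, h⟩ := h
  refine ⟨Set.mem_image_of_mem _ h0, ?_⟩
  induction h with
  | refl => exact Relation.ReflTransGen.refl
  | tail _ hbc ih => exact ih.tail ⟨φ.map_adj_iff.2 hbc.1, Set.mem_image_of_mem _ hbc.2⟩

/-- **The frame prism is internally connected from its centre** `(γ⁻¹ τ, v)`. [cite: KozmaNitzan2024, §4 p. 21 (v(P) + Λ_M)] -/
theorem pathIn_frameSeq [Countable W] {p : unitInterval} (hT : TubeSubcritical X p) (V₀ : Finset W) (γ : X ≃g X) (v : Site 2) (τ : W)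
    (n : ℕ) {s : W × Site 2} (hs : s ∈ frameSeq X hT V₀ γ v τ n) :
    PathIn (X □ zdGraph 2) (↑(frameSeq X hT V₀ γ v τ n) : Set (W × Site 2)) (γ.symm τ, v) s := by
  rw [frameSeq] at hs ⊢
  obtain ⟨s', hs', rfl⟩ := Finset.mem_image.1 hs
  have h := PathIn.map_iso (prodFrameIso X γ.symm v) (pathIn_ufatSeq X hT V₀ τ n hs')
  rw [Finset.coe_image]
  simpa [prodFrameIso_apply] using h

end BoxProdZ2

end Transplant

end Summit.CriticalPhenomena.PercolationContinuityZ3.Theorems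

end
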